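import Summits.CriticalPhenomena.PercolationContinuityZ3.Theorems.PercShatteringRaceNearLinearTwoClusterDecaySplit
import Summits.CriticalPhenomena.PercolationContinuityZ3.Theorems.PercNonProliferationDensityWhp
import HarnessLib

/-!
# Crux `PercShatteringRace.NearLinearTwoClusterDecay` (stmt-CriticalPhenomena-5785) — child 2 in the jump world

Helper file of the lead (seat c4) of the line `pair-decay-long-arms-dense`; lands with
`--supports stmt-CriticalPhenomena-5785` (registered certificate stub
`longArmsAreDense_of_theta_pos_of_nearLinearTwoClusterDecay`).

**`0 < θ(p_c) → U(1/6) → LongArmsAreDense`.**  The proposed sub-crux `LongArmsAreDense` (child 2 of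
the split `U ⇐ PairTwoArmsDecay ∧ LongArmsAreDense`, glue `nearLinearTwoClusterDecay_of_subs`) says:
for every `ε > 0` there is `κ > 0` such that, eventually in `n`, with probability `≥ 1 - ε` no
`x ∈ Λ(n)` has an in-box arm to `∂ⁱⁿΛ(m)`, `m = ⌈n^{7/6}⌉`, whose `Λ(m)`-cluster has a `κ`-thin
`Λ(n)`-trace.  In a JUMP WORLD `θ(p_c) > 0` this is already a consequence of the crux `U(1/6)` itself
(so child 2 carries new content only on the orthodox side `θ(p_c) = 0`):

* DENSITY (no Kesten–Zhang, every `p`): `P(#{z ∈ Λ(n) : z ↔ ∞} ≥ θ|Λ(n)|/2) → 1`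
  (`tendsto_measureReal_half_theta_le_percCount`, landed for route `PercNonProliferation`,
  Grimmett 1999 §7.4 (7.100)–(7.102) with the soft bound `θ_r ↓ θ` of §1.4);
* DETERMINISTIC CORE (`thinEvt_subset_twoCluster_union`): on a lattice configuration outside the
  crux event `twoCluster n m`, if `x ∈ Λ(n)` reaches `∂ⁱⁿΛ(m)` inside `Λ(m)` then EVERY percolating
  `z ∈ Λ(n)` lies in the `Λ(m)`-cluster of `x` (first exit of the infinite cluster of `z` from `Λ(m)`,
  `exists_openConnIn_innerBoundary_of_percolatesAt`, gives an in-box arm from `z`; were `z` not joined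
  to `x` inside `Λ(m)`, `(x, z)` would be a bad pair of `Λ(n)`, i.e. a crux configuration), so the
  trace of `x` has at least `#{z ∈ Λ(n) : z ↔ ∞}` points;
* hence with `κ = θ(p_c)/2`:
  `P(thinEvt n m κ) ≤ P(twoCluster n m) + P(#{z ∈ Λ(n) : z ↔ ∞} < θ|Λ(n)|/2) → 0`.

No new definitions; vocabulary (`Pc`, `outer`, `reachesOut`, `pairBad`, `twoCluster`, `trace`,
`thinEvt`, `thinEvt_eq`, `nearLinearTwoClusterDecay_iff_twoCluster`) from
`PercShatteringRaceNearLinearTwoClusterDecaySplit{Core,}.lean`, `percCount` from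
`Literature/Probability/Percolation/InfiniteClusterDensity.lean`.
-/

noncomputable section

namespace Summit.CriticalPhenomena.PercolationContinuityZ3.Theorems

namespace NearLinearTwoClusterDecaySplit

open MeasureTheory Filter Topology
open Literature.Probability.LatticeModels Literature.Probability.Percolation
open Summit.CriticalPhenomena.PercolationContinuityZ3.Theses.PercShatteringRace

/-! ## Density of the infinite cluster in boxes (every `p`, every `d ≥ 1`) -/

/-- The percolating count `K_B = #{x ∈ B : x ↔ ∞}` is a measurable (real-valued) function of the
configuration (finite sum of indicators of the measurable events `{x ↔ ∞}`). [folklore] -/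
theorem measurable_percCount_real {d : ℕ} (B : Finset (Site d)) :
    Measurable fun ω : BondConfig (Site d) => (percCount B ω : ℝ) := by
  classical
  have h : (fun ω : BondConfig (Site d) => (percCount B ω : ℝ)) =
      fun ω => ∑ x ∈ B, (percolatesAt x).indicator 1 ω := by
    funext ω
    rw [percCount_eq, Finset.card_filter]
    push_cast
    refine Finset.sum_congr rfl fun x _ => ?_
    by_cases hx : ω ∈ percolatesAt x <;> simp [hx]
  rw [h]
  exact Finset.measurable_sum _ fun x _ =>
    measurable_one.indicator (measurableSet_percolatesAt_holds x)

/-- **Density of the infinite cluster in boxes, deviation form** (every `p`, `d ≥ 1`): for every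
`δ > 0`, eventually in `n`, `P_p(¬ (θ(p)/2 · |Λ(n)| ≤ #{x ∈ Λ(n) : x ↔ ∞})) ≤ δ` — the complement
form of `tendsto_measureReal_half_theta_le_percCount` (Grimmett 1999 §7.4 (7.100)–(7.102), second
moment on local arm counts plus `θ_r ↓ θ`; no supercriticality needed). [folklore] -/
theorem eventually_measureReal_compl_percCount_ge_le {d : ℕ} (hd : 1 ≤ d) (p : unitInterval)
    {δ : ℝ} (hδ : 0 < δ) :
    ∀ᶠ n : ℕ in atTop, (bondPercolation (zdGraph d) p).real
      {ω | theta (zdGraph d) 0 p / 2 * ((box d n).card : ℝ) ≤ (percCount (box d n) ω : ℝ)}ᶜ ≤ δ := by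
  have h := tendsto_measureReal_half_theta_le_percCount hd p
  filter_upwards [(tendsto_order.1 h).1 (1 - δ) (by linarith)] with n hn
  have hE : {ω : BondConfig (Site d) |
      theta (zdGraph d) 0 p / 2 * ((box d n).card : ℝ) ≤ (percCount (box d n) ω : ℝ)} =
      {ω | theta (zdGraph d) 0 p * ((box d n).card : ℝ) / 2 ≤ (percCount (box d n) ω : ℝ)} := by
    ext ω
    simp only [Set.mem_setOf_eq]
    rw [div_mul_eq_mul_div]
  rw [hE, probReal_compl_eq_one_sub (measurableSet_le measurable_const (measurable_percCount_real _))]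
  linarith

/-! ## The deterministic core: outside the crux event, a long arm carries every infinite cluster of `Λ(n)` -/

/-- **Deterministic core.** Let `n ≤ m`, `ω ⊆ E(ℤ³)` a lattice configuration NOT in the crux event
`twoCluster n m`, and `x ∈ Λ(n)` with an in-box arm to `∂ⁱⁿΛ(m)`.  Then every percolating
`z ∈ Λ(n)` is joined to `x` inside `Λ(m)`: the first exit of the infinite cluster of `z` from
`Λ(m)` is an in-box arm from `z`, and two in-box arms from `Λ(n)` not joined inside `Λ(m)` would be
a bad pair.  Hence `#{z ∈ Λ(n) : z ↔ ∞} ≤ |trace n m ω x|`. [folklore] -/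
theorem percCount_le_card_trace {n m : ℕ} (hnm : n ≤ m) {x : Site 3} (hx : x ∈ box 3 n)
    {ω : BondConfig (Site 3)} (hω : ω ⊆ (zdGraph 3).edgeSet) (hreach : ω ∈ reachesOut m x)
    (htc : ω ∉ twoCluster n m) : percCount (box 3 n) ω ≤ (trace n m ω x).card := by
  classical
  rw [percCount_eq]
  refine Finset.card_le_card fun z hz => ?_
  rw [Finset.mem_filter] at hz
  simp only [trace, Finset.mem_filter]
  refine ⟨hz.1, ?_⟩
  by_contra hc
  obtain ⟨y, hy, hzy⟩ := exists_openConnIn_innerBoundary_of_percolatesAt (box_mono 3 hnm hz.1) hω hz.2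
  exact htc ⟨x, hx, z, hz.1, ⟨hreach, y, hy, hzy⟩, hc⟩

/-- **Inclusion of events** (lattice configurations): a `κ`-thin long arm from `Λ(n)` forces either
the crux event or a percolating count of `Λ(n)` below `κ|Λ(n)|`. [folklore] -/
theorem thinEvt_subset_twoCluster_union {n m : ℕ} (hnm : n ≤ m) (κ : ℝ) {ω : BondConfig (Site 3)}
    (hω : ω ⊆ (zdGraph 3).edgeSet) (h : ω ∈ thinEvt n m κ) :
    ω ∈ twoCluster n m ∪ {ω | κ * ((box 3 n).card : ℝ) ≤ (percCount (box 3 n) ω : ℝ)}ᶜ := by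
  obtain ⟨x, hx, hreach, hthin⟩ := h
  by_cases htc : ω ∈ twoCluster n m
  · exact Or.inl htc
  refine Or.inr fun hdense => ?_
  have hle : (percCount (box 3 n) ω : ℝ) ≤ (trace n m ω x).card := by
    exact_mod_cast percCount_le_card_trace hnm hx hω hreach htc
  simp only [Set.mem_setOf_eq] at hdense
  linarith

/-! ## Child 2 in the jump world -/

/-- **`0 < θ(p_c)` and decay of the crux event imply child 2, file-local vocabulary**, with the
explicit density `κ = θ(p_c)/2`:
`P(thinEvt n ⌈n^{7/6}⌉ (θ/2)) ≤ P(twoCluster n ⌈n^{7/6}⌉) + P(#{z ∈ Λ(n) : z ↔ ∞} < θ|Λ(n)|/2) → 0`. [folklore] -/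
theorem eventually_thinEvt_half_theta_le (h : Tendsto (fun n : ℕ => Pc.real (twoCluster n (outer n))) atTop (𝓝 0))
    {ε : ℝ} (hε : 0 < ε) :
    ∀ᶠ n : ℕ in atTop, Pc.real (thinEvt n (outer n) (theta (zdGraph 3) 0 (criticalProbI 3) / 2)) ≤ ε := by
  have h1 : ∀ᶠ n : ℕ in atTop, Pc.real (twoCluster n (outer n)) < ε / 2 :=
    (tendsto_order.1 h).2 _ (half_pos hε)
  have h2 := eventually_measureReal_compl_percCount_ge_le (d := 3) (by norm_num) (criticalProbI 3)
    (half_pos hε)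
  filter_upwards [h1, h2] with n hn1 hn2
  have hle : n ≤ outer n := le_nat_ceil_rpow (by norm_num : (1 : ℝ) ≤ 7 / 6) n
  calc Pc.real (thinEvt n (outer n) (theta (zdGraph 3) 0 (criticalProbI 3) / 2))
      ≤ Pc.real (twoCluster n (outer n) ∪
          {ω | theta (zdGraph 3) 0 (criticalProbI 3) / 2 * ((box 3 n).card : ℝ) ≤
            (percCount (box 3 n) ω : ℝ)}ᶜ) :=
        DCT16.real_mono_of_forall_subset_edgeSet (zdGraph 3) (criticalProbI 3) fun ω hω hmem =>
          thinEvt_subset_twoCluster_union hle _ hω hmem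
    _ ≤ Pc.real (twoCluster n (outer n)) +
          Pc.real {ω | theta (zdGraph 3) 0 (criticalProbI 3) / 2 * ((box 3 n).card : ℝ) ≤
            (percCount (box 3 n) ω : ℝ)}ᶜ := measureReal_union_le _ _
    _ ≤ ε / 2 + ε / 2 := add_le_add hn1.le hn2
    _ = ε := add_halves ε

/-- **Child 2 in the jump world, file-local vocabulary**: if `0 < θ(p_c)` and the crux event decays,
then for every `ε > 0` there is `κ > 0` (namely `θ(p_c)/2`) with eventually
`P(thinEvt n ⌈n^{7/6}⌉ κ) ≤ ε`. [folklore] -/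
theorem longArmsDense'_of_theta_pos_of_tendsto (hθ : 0 < theta (zdGraph 3) 0 (criticalProbI 3))
    (h : Tendsto (fun n : ℕ => Pc.real (twoCluster n (outer n))) atTop (𝓝 0)) :
    ∀ ε : ℝ, 0 < ε → ∃ κ : ℝ, 0 < κ ∧ ∀ᶠ n : ℕ in atTop, Pc.real (thinEvt n (outer n) κ) ≤ ε :=
  fun _ hε => ⟨theta (zdGraph 3) 0 (criticalProbI 3) / 2, half_pos hθ, eventually_thinEvt_half_theta_le h hε⟩

end NearLinearTwoClusterDecaySplit

open MeasureTheory Filter Topology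
open Literature.Probability.LatticeModels Literature.Probability.Percolation
open Summit.CriticalPhenomena.PercolationContinuityZ3.Theses.PercShatteringRace
open NearLinearTwoClusterDecaySplit

/-- **Certificate stub `longArmsAreDense_of_theta_pos_of_nearLinearTwoClusterDecay` of the line
`pair-decay-long-arms-dense`** (registered): NECESSITY OF CHILD 2 IN THE JUMP WORLD.  If
`0 < θ(p_c)` and the crux `NearLinearTwoClusterDecay` (`U(1/6)`) holds, then `LongArmsAreDense` holds:
for every `ε > 0` there is `κ > 0` such that eventually the probability that some `x ∈ Λ(n)` has an
in-box arm to `∂ⁱⁿΛ(⌈n^{7/6}⌉)` while its `Λ(⌈n^{7/6}⌉)`-cluster has fewer than `κ|Λ(n)|` points in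
`Λ(n)` is `≤ ε`.  Proof: `κ = θ(p_c)/2`; outside the crux event a long arm from `Λ(n)` absorbs every
infinite cluster meeting `Λ(n)` (first exits), and `#{z ∈ Λ(n) : z ↔ ∞} ≥ θ|Λ(n)|/2` w.h.p. by the
second-moment density bound (Grimmett 1999 §7.4, every `p`). [folklore] -/
theorem longArmsAreDense_of_theta_pos_of_nearLinearTwoClusterDecay
    (hθ : 0 < theta (zdGraph 3) 0 (criticalProbI 3))
    (hU : Summit.CriticalPhenomena.PercolationContinuityZ3.Theses.PercShatteringRace.NearLinearTwoClusterDecay) :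
    ∀ ε : ℝ, 0 < ε → ∃ κ : ℝ, 0 < κ ∧ ∀ᶠ n : ℕ in Filter.atTop,
      (bondPercolation (zdGraph 3) (criticalProbI 3)).real
        {ω | ∃ x ∈ box 3 n,
          (∃ y ∈ innerBoundary (zdGraph 3) (box 3 ⌈(n : ℝ) ^ ((7 : ℝ) / 6)⌉₊),
            ω ∈ openConnIn ↑(box 3 ⌈(n : ℝ) ^ ((7 : ℝ) / 6)⌉₊) x y) ∧
          (Set.ncard {z : Site 3 | z ∈ box 3 n ∧
              ω ∈ openConnIn ↑(box 3 ⌈(n : ℝ) ^ ((7 : ℝ) / 6)⌉₊) x z} : ℝ) < κ * (box 3 n).card} ≤ ε := by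
  intro ε hε
  obtain ⟨κ, hκ, hev⟩ :=
    longArmsDense'_of_theta_pos_of_tendsto hθ (nearLinearTwoClusterDecay_iff_twoCluster.1 hU) ε hε
  refine ⟨κ, hκ, ?_⟩
  filter_upwards [hev] with n hn
  rwa [← thinEvt_eq]

/-- **Jump-world profile of child 2** (corollary, for citation): if `0 < θ(p_c)` then
`NearLinearTwoClusterDecay → LongArmsAreDense`; together with the landed necessity of child 1
(`pairTwoArmsDecay_of_nearLinearTwoClusterDecay`) and the glue `nearLinearTwoClusterDecay_of_subs`,
in a jump world the split `U ⇐ PairTwoArmsDecay ∧ LongArmsAreDense` is LOSSLESS: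
`U ↔ PairTwoArmsDecay ∧ LongArmsAreDense`. [folklore] -/
theorem nearLinearTwoClusterDecay_iff_pair_and_longArmsAreDense_of_theta_pos
    (hθ : 0 < theta (zdGraph 3) 0 (criticalProbI 3)) :
    Summit.CriticalPhenomena.PercolationContinuityZ3.Theses.PercShatteringRace.NearLinearTwoClusterDecay ↔
    ((∀ ε : ℝ, 0 < ε → ∀ᶠ n : ℕ in Filter.atTop, ∀ x ∈ box 3 n, ∀ x' ∈ box 3 n,
      (bondPercolation (zdGraph 3) (criticalProbI 3)).real
        {ω | ∃ y ∈ innerBoundary (zdGraph 3) (box 3 ⌈(n : ℝ) ^ ((7 : ℝ) / 6)⌉₊),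
          ∃ y' ∈ innerBoundary (zdGraph 3) (box 3 ⌈(n : ℝ) ^ ((7 : ℝ) / 6)⌉₊),
            ω ∈ openConnIn ↑(box 3 ⌈(n : ℝ) ^ ((7 : ℝ) / 6)⌉₊) x y ∧
            ω ∈ openConnIn ↑(box 3 ⌈(n : ℝ) ^ ((7 : ℝ) / 6)⌉₊) x' y' ∧
            ω ∉ openConnIn ↑(box 3 ⌈(n : ℝ) ^ ((7 : ℝ) / 6)⌉₊) x x'} ≤ ε) ∧
    (∀ ε : ℝ, 0 < ε → ∃ κ : ℝ, 0 < κ ∧ ∀ᶠ n : ℕ in Filter.atTop,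
      (bondPercolation (zdGraph 3) (criticalProbI 3)).real
        {ω | ∃ x ∈ box 3 n,
          (∃ y ∈ innerBoundary (zdGraph 3) (box 3 ⌈(n : ℝ) ^ ((7 : ℝ) / 6)⌉₊),
            ω ∈ openConnIn ↑(box 3 ⌈(n : ℝ) ^ ((7 : ℝ) / 6)⌉₊) x y) ∧
          (Set.ncard {z : Site 3 | z ∈ box 3 n ∧
              ω ∈ openConnIn ↑(box 3 ⌈(n : ℝ) ^ ((7 : ℝ) / 6)⌉₊) x z} : ℝ) < κ * (box 3 n).card} ≤ ε)) :=
  ⟨fun hU => ⟨pairTwoArmsDecay_of_nearLinearTwoClusterDecay hU,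
      longArmsAreDense_of_theta_pos_of_nearLinearTwoClusterDecay hθ hU⟩,
    fun h => nearLinearTwoClusterDecay_of_subs h.1 h.2⟩

end Summit.CriticalPhenomena.PercolationContinuityZ3.Theorems
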